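import Summits.QuantumFields.YangMills.Theorems.UnitScaleTiltFluctuationComparisonRegPrGlobalSlackCanonicalPolymersJetStepInputsV4
import Summits.QuantumFields.YangMills.Theorems.UnitScaleTiltFluctuationComparisonRegPrGlobalSlackCanonicalPolymersJetStep
import HarnessLib

/-!
# `UnitScaleTiltFluctuationComparisonRegPrGlobalSlackCanonicalPolymersJetStepV4` — THE v4 TWIN (★★OWNER RULING g26-№14 (F-2b); P22b polymer-step branch, width seat ym-ust-20520-w2 g4; skeleton v5kD; record-free decls imported from `…GlobalSlackCanonicalPolymersJetStep`) of `…GlobalSlackCanonicalPolymersJetStep` — THE RETAINED-JET TWO-RUN ROW OF THE STEP CHARTS FROM KING'S FLAT-KERNEL COMPARISON AND THE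
# CONFIGURATION COMPARISON, BOTH STATED ON THE DISPLAYED `Ψ` / `Bcfg` OF THE TWO RUNS' STEP RECORDS; SIZES AND COLLAR POLYLOGARITHMS DISCHARGED
# (crux `FluctuationComparisonRegPrIntL`, stmt-QuantumFields-20520, skeleton v5kC STUBS 3⁗χ / (i*)χ; PEN = width seat ym-ust-20520-w2 g0's draft
# `pub/ym3-torus/ym-ust-20520-w2/DRAFT-JetStep-full-typing-seam.lean`; typing seam closed and filed by lane B seat ym-ust-19935-r1 g5)

WHY.  `…CanonicalPolymersNewTermSplit` (w2 g0, p584833) left the newborn two-run row of (i*)χ/3⁗χ as `JetStepSlackOnRows` (the retained jets of the STEP charts compared across the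
two runs) + the Λ-family residual; `…JetStepInputs` (w2 g0, p587547) typed the displayed step charts/configurations in the family's bond coordinates (`chartAt`, `cfgAt`) and proved
the displayed inputs (`window_cfg_le_one`, `norm_kernelRows_le_of_chart`, `norm_kernelTRows_le_of_chart`, `rsq_mul_rpow_le`, `norm_pullback_le`).  This file proves `JetStepSlackOnRows` from the
two genuinely two-run statements of King's mechanism, stated on the objects the step records DISPLAY:

* §1 **`K1aStepΨRows q κ₁ a C`** — THE UNPRINTED NUMBER COMPARISON ([King1986] Prop. 3.6 (3.56) for SU(2), d = 3) for the displayed charts: for every retained domain `X` of step `k` of run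
  `K` and every order `2 ≤ d ≤ 6`, `‖Dᵈ(Ψ^{K+1}_{k+1, domCast X})(0) ∘ transport − Dᵈ(Ψ^{K}_{k, X})(0)‖ ≤ C·e^{−κ₁·dj X}·L^{−a(1+k)}` (configuration-free; hypothesis schema);
  **`CfgCauchyStepOnRows S q b₀ p₀ a C_B`** — the two runs' displayed chart configurations `Bcfg` at matched domains and fields, run `K+1`'s pulled back along the bond matching, differ
  by `C_B·(r(g_k)g_kp(g_k))·L^{−a(1+k)}` on doubly-`S`-good window data — (28)'s OWN scale times the rate ([King1986] Prop. 3.9; the 19200-side content; hypothesis schema);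
* §2 **`jet_re_diff_ml_transport`** — lane A's pointwise jet algebra `GlobalSlackKernelMatching.jet_re_diff_ml` stated ONCE over a generic coefficient space `𝕍` with `T := transport 𝕍 F K b`
  (THE SEAM: at the concrete `𝔰𝔲(2)ᶜ` space the generic `T`-binder form and the displayed rows carry two different instance paths on `(PBond → 𝕍) [×d]→L[ℂ] ℂ` whose unification does
  not terminate in 4·10⁶ heartbeats; with the transport literal in the statement both sides carry the same path and the concrete instance is a substitution — elaborates in seconds);
* §3 **`jetStepSlackOnRows_of_k1a_cfgCauchy`**: `K1aStepΨRows q κ₁ a C ∧ CfgCauchyStepOnRows S q 𝔠.b₀ 𝔠.p₀ a C_B ⟹ JetStepSlackOnRows S q 𝔠.b₀ 𝔠.p₀ κ₁ (θ²) (a(1−t)) C_J` for every `0 < t ≤ 1`,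
  `κ₁ ≤ 𝔠.κ`, `0 ≤ a`, with `C_J = 5·(cB²·C^{1−t}(2C_E)^t·M(2r₀,t) + 6·cB·C_B·C_E·M(2r₀,1))`, `C_E = C25·(max 1 (12/ρ))⁶`, shift `0` — the K1a rate interpolated against the kept-`g`
  kernel size to pay `bound28`'s `r(g)²`, `r(g)²gᵗ ≤ M(2r₀,t)`, `(g_kp(g_k))² = θ(n+1)² ≤ θ(n)²`.
UPSHOT, BY NAME: (i*)χ/3⁗χ ⇐ `K1aStepΨRows` + `CfgCauchyStepOnRows χ` (two-run rows on DISPLAYED step-record fields) + `LambdaTermSlackOnRows` (g-free family; feedable at a higher log-profile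
through ★r1 g5's doors `…GlobalSlackTwoProfile` / `…GlobalSlackHigherProfile`) + `OldTermSlackOnRows` ((M1)'s value row); everything else of the newborn row is a THEOREM of the χ-package's
displayed rows.  Nothing of [Balaban1985UV3]/[King1986] is asserted; no numerics; registry untouched (`--supports stmt-QuantumFields-20520`).  YM₃ on the torus is a rung of the
ladder, not the Clay problem; nothing here is a claim about the crux or the gap.

References: C. King, CMP 102 (1986) 649–677 [King1986] (Prop. 3.6 (3.55)–(3.56) p.662, Prop. 3.8 (3.71) p.664, Prop. 3.9 (3.73)–(3.75) p.665, Thm 3.4 (3.9) p.656); T. Bałaban,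
CMP 102 (1985) 255–275 [Balaban1985UV3] ((7) p.257, (25) p.262, (28) p.263, (33)–(34) p.264, (59)–(60) pp.270–271); S. B. Chae, Holomorphy and Calculus in Normed Spaces (1985)
[Chae1985] (13.6).
-/

set_option autoImplicit false

noncomputable section

namespace Summit.QuantumFields.YangMills.Theorems.GlobalSlackCanonicalPolymers

open scoped BigOperators
open Finset
open Literature.MathematicalPhysics.QuantumFieldTheory.Balaban1983to89
open Literature.MathematicalPhysics.QuantumFieldTheory.Balaban1983to89.T3ContinuumYM3Torus
open Literature.MathematicalPhysics.QuantumFieldTheory.Balaban1983to89.T3UnitScaleTilt (θBal)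
open Literature.MathematicalPhysics.QuantumFieldTheory.Balaban1983to89.T3LevelShift (fieldShift)
open Literature.MathematicalPhysics.QuantumFieldTheory.Balaban1983to89.T3Thresholds (θBal_succ_le)
open Literature.MathematicalPhysics.QuantumFieldTheory.Balaban1983to89.T3AlphaInputsAC
open Literature.MathematicalPhysics.QuantumFieldTheory.Balaban1983to89.T3AlphaPolymerSocket
open Literature.MathematicalPhysics.QuantumFieldTheory.Balaban1983to89.T3AlphaInputsACTwoRunLevel
open Literature.MathematicalPhysics.QuantumFieldTheory.Balaban1983to89.TreeLengthTorus (tsys TPt)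
open Literature.MathematicalPhysics.QuantumFieldTheory.Balaban1985CMP102
open Literature.MathematicalPhysics.QuantumFieldTheory.Balaban1985CMP102.Setting
open Literature.MathematicalPhysics.QuantumFieldTheory.Balaban1985CMP102.Binders (ChartAnalyticityAsCited)
open Summit.QuantumFields.Balaban3D.Carriers
open Summit.QuantumFields.Balaban3D.Proofs.Primitives
open Summit.QuantumFields.Balaban3D.Proofs.GroupModelLieC (lieC)
open Summit.QuantumFields.Balaban3D.Proofs.Representation33 (jet26)
open Summit.QuantumFields.Balaban3D.Proofs.NewbornJet (rFun_pow)
open Summit.QuantumFields.Balaban3D.Proofs.ScalesArithmetic (gk_pos gk_le_one)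
open Summit.QuantumFields.YangMills.Theorems
open Summit.QuantumFields.YangMills.Theorems.GlobalSlackKernelMatching
open Summit.QuantumFields.YangMills.Theorems.GlobalSlackKernelMatchingOn (WinPred)
open Summit.QuantumFields.YangMills.Theorems.GlobalSlackKernelRescale (logPowConst logPowConst_pos rpow_mul_logpow_le min_le_rpow_mul_rpow)

variable {F : T3Family} {𝔠 : AlphaConsts F.L (suGroupModel 2).N} {γ : ℝ} {hγ : 0 < γ} {hγ1 : γ ≤ (min 𝔠.gamma0 1) ^ 2}

/-! ## §1 The two two-run rows of King's mechanism, on the displayed step-record fields -/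

/-- **K1a FOR THE DISPLAYED STEP CHARTS** (hypothesis schema, never asserted) — the unprinted two-run NUMBER comparison of [King1986] Prop. 3.6 (3.56) for SU(2), d = 3: for every
retained domain `X` of step `k` of run `K` and every order `2 ≤ d ≤ 6`, the order-`d` flat kernel of run `K+1`'s step-`(k+1)` chart at the transported domain, pulled back along the
bond transport, and run `K`'s step-`k` flat kernel at `X` differ in operator norm by `C·e^{−κ₁·dj X}·L^{−a(1+k)}`.  Configuration-free.
[cite: King1986, Prop. 3.6 (3.56) p.662, Prop. 3.9 (3.74) p.665; Balaban1985UV3, (33)-(34) p.264] -/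
def K1aStepΨRows (q : ∀ K, AlphaInputsT3AC.PkgCoreRows F 𝔠 γ hγ hγ1 K) (κ₁ a C : ℝ) : Prop :=
  ∀ (K k : ℕ) (hk : k + 1 ≤ K), ∀ X ∈ newDomsRows q K k (Hist.triv (F.P K) (k + 1)), ∀ d ∈ Finset.Ico 2 7,
    ‖(iteratedFDeriv ℂ d (chartAtRows q (K + 1) (k + 1) (domCast (nblkOf_succ_eq (hγ := hγ) (hγ1 := hγ1) K k) X)) 0).compContinuousLinearMap
          (fun _ => transport ↥(lieC (suGroupModel 2)) F K k) -
        iteratedFDeriv ℂ d (chartAtRows q K k X) 0‖ ≤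
      C * Real.exp (-κ₁ * (tsys 3 (nblkOf (SK F 𝔠 γ hγ hγ1 K) 𝔠.lane.carrier k)).dj X) * (((F.L : ℝ) ^ (1 + k))⁻¹) ^ a

/-- **THE CONFIGURATION CAUCHY ROW FOR THE DISPLAYED STEP CONFIGURATIONS, ON `S`** (hypothesis schema, never asserted): at matched retained domains and matched readings of a
doubly-`S`-good window datum, run `K+1`'s chart configuration pulled back along the bond matching minus run `K`'s differs in sup norm by `C_B·(r(g_k)g_kp(g_k))·L^{−a(1+k)}` — (28)'s
own scale `cB·r(g_k)g_kp(g_k)` of the displayed size row `bound28`, times the rate (the 19200-side two-run comparison of the loop variables, [King1986] Props. 3.8–3.9 (3.71)–(3.75)).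
[cite: King1986, Prop. 3.8 (3.71) p.664, Prop. 3.9 (3.73)-(3.75) p.665; Balaban1985UV3, (27)-(28) p.263, (47) p.267] -/
def CfgCauchyStepOnRows (S : WinPred F) (q : ∀ K, AlphaInputsT3AC.PkgCoreRows F 𝔠 γ hγ hγ1 K) (b₀ p₀ a C_B : ℝ) : Prop :=
  ∀ (K n : ℕ) (h : n ≤ K) (k : ℕ) (hk : K - n = k + 1),
    ∀ V : GaugeField (F.P n) 0 (Matrix.specialUnitaryGroup (Fin 2) ℂ), PlaqSmall (θBal F.L γ b₀ p₀ n) V →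
      S K n h V → S (K + 1) n (h.trans (Nat.le_succ K)) V →
      ∀ X ∈ newDomsRows q K k (Hist.triv (F.P K) (k + 1)),
        ‖(fun c => cfgAtRows q (K + 1) (k + 1) (domCast (nblkOf_succ_eq (hγ := hγ) (hγ1 := hγ1) K k) X)
              (fieldShift (F.sitesPerDir_eq (m := F.m) (K := K + 1) (j := k + 1 + 1) (m' := F.m) (K' := n) (j' := 0) (by omega)) V)
              (matchBond F K k c)) -
          cfgAtRows q K k X (fieldShift (F.sitesPerDir_eq (m := F.m) (K := K) (j := k + 1) (m' := F.m) (K' := n) (j' := 0) (by omega)) V)‖ ≤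
        C_B * (B10.rFun 𝔠.r₀ ((SK F 𝔠 γ hγ hγ1 K).gk k) * (SK F 𝔠 γ hγ hγ1 K).gk k * B10.pFun 𝔠.b₀ 𝔠.p₀ ((SK F 𝔠 γ hγ hγ1 K).gk k)) *
          (((F.L : ℝ) ^ (1 + k))⁻¹) ^ a


/-! ## §2 Lane A's pointwise jet algebra, specialised to the bond transport (generic coefficient space) -/

section Transport

variable {𝕍 : Type} [NormedAddCommGroup 𝕍] [NormedSpace ℂ 𝕍]

-- (record-free `jet_re_diff_ml_transport`: imported from the v3 module, not restated)

end Transport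

/-! ## §3 The jet row from K1a and the configuration Cauchy row -/

/-- **THE RETAINED-JET TWO-RUN ROW OF THE STEP CHARTS FROM K1a AND THE CONFIGURATION CAUCHY ROW — SIZES AND POLYLOGARITHMS DISCHARGED FROM THE DISPLAYS.**  For `κ₁ ≤ 𝔠.κ`,
`0 ≤ a`, `0 < t ≤ 1`, `√γ ≤ e^{1−p₀}` (so `θ(n+1) ≤ θ(n)`), the configuration window `cB·r(g_k)g_kp(g_k) ≤ 1` (from `γ` small, `window_cfg_le_one`), `0 ≤ C`, `0 ≤ C_B`:
`K1aStepΨRows q κ₁ a C ∧ CfgCauchyStepOnRows S q b₀ p₀ a C_B ⟹ JetStepSlackOnRows S q b₀ p₀ κ₁ (θ²) (a(1−t)) (5·(cB²·C^{1−t}(2C_E)ᵗ·M(2r₀,t) + 6·cB·C_B·C_E·M(2r₀,1)))`,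
`C_E = C25·(max 1 (12/ρ))⁶`, shift `0`.  At one `(K, n, k, V, X)`: lane A's `jet_re_diff_ml` with the transport, the two displayed charts, run `K`'s displayed configuration
and the pull-back of run `K+1`'s (`transport_pullback`), sizes `cB·(r g p)` from `bound28` of BOTH runs (`gk_succ_eq`), the kernel difference interpolated between K1a and the
kept-`g` kernel sizes (`min ≤ A^{1−t}Bᵗ`), then `r(g)²gᵗ ≤ M(2r₀,t)`, `r(g)²g ≤ M(2r₀,1)` and `(g_kp(g_k))² = θ(n+1)² ≤ θ(n)²`.
[cite: King1986, Prop. 3.6 (3.55)-(3.56) p.662, Prop. 3.8 (3.71) p.664; Balaban1985UV3, (25) p.262, (28) p.263, (33)-(34) p.264, (7) p.257] -/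
theorem jetStepSlackOnRows_of_k1a_cfgCauchy (S : WinPred F) (q : ∀ K, AlphaInputsT3AC.PkgCoreRows F 𝔠 γ hγ hγ1 K) {b₀ p₀ κ₁ a C C_B t : ℝ}
    (hκ₁ : κ₁ ≤ 𝔠.κ) (ha : 0 ≤ a) (ht : 0 < t) (ht1 : t ≤ 1) (hγe : Real.sqrt γ ≤ Real.exp (1 - 𝔠.p₀)) (hC : 0 ≤ C) (hCB : 0 ≤ C_B)
    (hwin : ∀ K k, k + 1 ≤ K →
      𝔠.cB * (B10.rFun 𝔠.r₀ ((SK F 𝔠 γ hγ hγ1 K).gk k) * (SK F 𝔠 γ hγ hγ1 K).gk k * B10.pFun 𝔠.b₀ 𝔠.p₀ ((SK F 𝔠 γ hγ hγ1 K).gk k)) ≤ 1)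
    (hK : K1aStepΨRows q κ₁ a C) (hB : CfgCauchyStepOnRows S q b₀ p₀ a C_B) :
    JetStepSlackOnRows S q b₀ p₀ κ₁ (fun n => θBal F.L γ 𝔠.b₀ 𝔠.p₀ n ^ 2) (a * (1 - t))
      (5 * (𝔠.cB ^ 2 * (C ^ (1 - t) * (2 * (𝔠.C25 * (max 1 (12 / 𝔠.ρ)) ^ 6)) ^ t * logPowConst (2 * 𝔠.r₀) t) +
        6 * 𝔠.cB * C_B * (𝔠.C25 * (max 1 (12 / 𝔠.ρ)) ^ 6 * logPowConst (2 * 𝔠.r₀) 1))) := by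
  have hL : 1 ≤ F.L := F.hL.2.le
  have hL1 : (1 : ℝ) ≤ (F.L : ℝ) := by exact_mod_cast hL
  have hγ1' : γ ≤ 1 := hγ1.trans (sq_min_one_le _ 𝔠.gamma0_pos)
  have hr : 0 ≤ 𝔠.r₀ := le_trans zero_le_one 𝔠.one_le_r₀
  have hcB := 𝔠.cB_nonneg
  set C_E : ℝ := 𝔠.C25 * (max 1 (12 / 𝔠.ρ)) ^ 6 with hCEdef
  have hCE : 0 ≤ C_E := by have := 𝔠.C25_nonneg; positivity
  refine ⟨fun _ _ _ => 0, fun K n hn k hk V hV hS hS' X hX => ?_⟩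
  have hkK : k + 1 ≤ K := by omega
  have hKk : K - k = n + 1 := by omega
  -- letters (local definitions; no abstraction over the goal)
  let g : ℝ := (SK F 𝔠 γ hγ hγ1 K).gk k
  let pg : ℝ := B10.pFun 𝔠.b₀ 𝔠.p₀ g
  let r : ℝ := B10.rFun 𝔠.r₀ g
  let d₀ : ℝ := (tsys 3 (nblkOf (SK F 𝔠 γ hγ hγ1 K) 𝔠.lane.carrier k)).dj X
  let e₀ : ℝ := Real.exp (-(𝔠.κ * d₀))
  let e₁ : ℝ := Real.exp (-κ₁ * d₀)
  let ρ : ℝ := (((F.L : ℝ) ^ (1 + k))⁻¹) ^ a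
  let ρ' : ℝ := (((F.L : ℝ) ^ (1 + k))⁻¹) ^ (a * (1 - t))
  let θ' : ℝ := r * g * pg
  have hg0 : 0 < g := gk_pos _ k
  have hg1 : g ≤ 1 := gk_le_one _ (SK F 𝔠 γ hγ hγ1 K).gK_le_one k (by show k ≤ K; omega)
  have hpg0 : 0 ≤ pg := B10.pFun_nonneg _ _ _ 𝔠.b₀_pos.le hg0 hg1
  have hr0 : 0 ≤ r := by
    show 0 ≤ B10.rFun 𝔠.r₀ g
    unfold B10.rFun; exact Real.rpow_nonneg (by linarith [B10.log_inv_nonneg_of_le_one hg0 hg1]) _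
  have hd₀ : 0 ≤ d₀ := (tsys 3 (nblkOf (SK F 𝔠 γ hγ hγ1 K) 𝔠.lane.carrier k)).dj_nonneg X
  have he₀ : 0 ≤ e₀ := (Real.exp_pos _).le
  have he₁ : 0 ≤ e₁ := (Real.exp_pos _).le
  have he₁pos : 0 < e₁ := Real.exp_pos _
  have he01 : e₀ ≤ e₁ := Real.exp_le_exp.mpr (by nlinarith)
  have hx0 : 0 ≤ ((F.L : ℝ) ^ (1 + k))⁻¹ := by positivity
  have hx1 : ((F.L : ℝ) ^ (1 + k))⁻¹ ≤ 1 := inv_le_one_of_one_le₀ (one_le_pow₀ hL1)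
  have hρ0 : 0 ≤ ρ := Real.rpow_nonneg hx0 _
  have hρ'0 : 0 ≤ ρ' := Real.rpow_nonneg hx0 _
  have hρρ' : ρ ≤ ρ' := Real.rpow_le_rpow_of_exponent_ge (by positivity) hx1 (by nlinarith)
  have hρt : ρ ^ (1 - t) = ρ' := by
    show ((((F.L : ℝ) ^ (1 + k))⁻¹) ^ a) ^ (1 - t) = (((F.L : ℝ) ^ (1 + k))⁻¹) ^ (a * (1 - t))
    rw [← Real.rpow_mul hx0]
  have hθ'0 : 0 ≤ θ' := by positivity
  have hsθ : 𝔠.cB * θ' ≤ 1 := hwin K k hkK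
  have heps : g * pg = θBal F.L γ 𝔠.b₀ 𝔠.p₀ (n + 1) := by rw [← hKk]; exact (q K).eps1_eq k (by omega)
  -- the objects (local definitions)
  let T := transport ↥(lieC (suGroupModel 2)) F K k
  let Ψ₀ := chartAtRows q K k X
  let Ψ₁ := chartAtRows q (K + 1) (k + 1) (domCast (nblkOf_succ_eq (hγ := hγ) (hγ1 := hγ1) K k) X)
  let W : GaugeField (F.P K) (k + 1) (Matrix.specialUnitaryGroup (Fin 2) ℂ) :=
    fieldShift (F.sitesPerDir_eq (m := F.m) (K := K) (j := k + 1) (m' := F.m) (K' := n) (j' := 0) (by omega)) V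
  let W' : GaugeField (F.P (K + 1)) (k + 1 + 1) (Matrix.specialUnitaryGroup (Fin 2) ℂ) :=
    fieldShift (F.sitesPerDir_eq (m := F.m) (K := K + 1) (j := k + 1 + 1) (m' := F.m) (K' := n) (j' := 0) (by omega)) V
  let B₀ := cfgAtRows q K k X W
  let B₁' := cfgAtRows q (K + 1) (k + 1) (domCast (nblkOf_succ_eq (hγ := hγ) (hγ1 := hγ1) K k) X) W'
  let B₁ : PBond (F.P K) k → ↥(lieC (suGroupModel 2)) := fun c => B₁' (matchBond F K k c)
  have hTB₁ : transport ↥(lieC (suGroupModel 2)) F K k B₁ = B₁' := transport_pullback K k B₁'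
  have hc0 : 0 ≤ C ^ (1 - t) * (2 * C_E) ^ t * g ^ t :=
    mul_nonneg (mul_nonneg (Real.rpow_nonneg hC _) (Real.rpow_nonneg (by linarith) _)) (Real.rpow_nonneg hg0.le _)
  -- the five object hypotheses
  have h₁ : ‖B₀‖ ≤ 𝔠.cB * θ' * 1 ^ 2 := by
    rw [one_pow, mul_one]; exact ((q K).runRows.steps k hkK).bound28 X (Hist.triv (F.P K) (k + 1)) W
  have h₂ : ‖B₁‖ ≤ 𝔠.cB * θ' * 1 ^ 2 := by
    rw [one_pow, mul_one]
    have h0 := ((q (K + 1)).runRows.steps (k + 1) (show k + 1 + 1 ≤ K + 1 by omega)).bound28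
      (domCast (nblkOf_succ_eq (hγ := hγ) (hγ1 := hγ1) K k) X) (Hist.triv (F.P (K + 1)) (k + 1 + 1)) W'
    rw [gk_succ_eq (hγ := hγ) (hγ1 := hγ1) K k (by omega)] at h0
    exact (norm_pullback_le K k B₁').trans h0
  have h₃ : ‖B₁ - B₀‖ ≤ C_B * θ' * 1 ^ 2 * ρ' := by
    rw [one_pow, mul_one]
    exact (hB K n hn k hk V hV hS hS' X hX).trans (mul_le_mul_of_nonneg_left hρρ' (mul_nonneg hCB hθ'0))
  have h₅ : ∀ d ∈ Finset.Ico 2 7, ‖iteratedFDeriv ℂ d Ψ₀ 0‖ ≤ C_E * g * e₁ := fun d hd => by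
    have hd6 : d ≤ 6 := by have := (Finset.mem_Ico.mp hd).2; omega
    exact (norm_kernelRows_le_of_chart q K k hkK X hd6).trans (mul_le_mul_of_nonneg_left he01 (mul_nonneg hCE hg0.le))
  have h₄ : ∀ d ∈ Finset.Ico 2 7, ‖(iteratedFDeriv ℂ d Ψ₁ 0).compContinuousLinearMap (fun _ => T) - iteratedFDeriv ℂ d Ψ₀ 0‖ ≤
      C ^ (1 - t) * (2 * C_E) ^ t * g ^ t * e₁ * ρ' := fun d hd => by
    have hd6 : d ≤ 6 := by have := (Finset.mem_Ico.mp hd).2; omega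
    have hN1 : ‖(iteratedFDeriv ℂ d Ψ₁ 0).compContinuousLinearMap (fun _ => T) - iteratedFDeriv ℂ d Ψ₀ 0‖ ≤ C * e₁ * ρ := hK K k hkK X hX d hd
    have hE1 : ‖(iteratedFDeriv ℂ d Ψ₁ 0).compContinuousLinearMap (fun _ => T)‖ ≤ C_E * g * e₁ :=
      (norm_kernelTRows_le_of_chart q K k hkK X hd6).trans (mul_le_mul_of_nonneg_left he01 (mul_nonneg hCE hg0.le))
    have hN2 : ‖(iteratedFDeriv ℂ d Ψ₁ 0).compContinuousLinearMap (fun _ => T) - iteratedFDeriv ℂ d Ψ₀ 0‖ ≤ 2 * C_E * g * e₁ := by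
      calc ‖(iteratedFDeriv ℂ d Ψ₁ 0).compContinuousLinearMap (fun _ => T) - iteratedFDeriv ℂ d Ψ₀ 0‖
          ≤ ‖(iteratedFDeriv ℂ d Ψ₁ 0).compContinuousLinearMap (fun _ => T)‖ + ‖iteratedFDeriv ℂ d Ψ₀ 0‖ :=
            norm_sub_le ((iteratedFDeriv ℂ d Ψ₁ 0).compContinuousLinearMap (fun _ => T)) (iteratedFDeriv ℂ d Ψ₀ 0)
        _ ≤ C_E * g * e₁ + C_E * g * e₁ := add_le_add hE1 (h₅ d hd)
        _ = 2 * C_E * g * e₁ := by ring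
    have hA0 : 0 ≤ C * e₁ * ρ := by positivity
    have h2CE : 0 ≤ 2 * C_E := by linarith
    have hB0 : 0 ≤ 2 * C_E * g * e₁ := by positivity
    have hint := (le_min hN1 hN2).trans (min_le_rpow_mul_rpow hA0 hB0 ht.le ht1)
    have hee : e₁ ^ (1 - t) * e₁ ^ t = e₁ := by rw [← Real.rpow_add he₁pos, sub_add_cancel, Real.rpow_one]
    have hexp : (C * e₁ * ρ) ^ (1 - t) * (2 * C_E * g * e₁) ^ t = C ^ (1 - t) * (2 * C_E) ^ t * g ^ t * e₁ * ρ' := by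
      rw [Real.mul_rpow (mul_nonneg hC he₁) hρ0, Real.mul_rpow hC he₁, Real.mul_rpow (mul_nonneg h2CE hg0.le) he₁, Real.mul_rpow h2CE hg0.le, hρt]
      calc C ^ (1 - t) * e₁ ^ (1 - t) * ρ' * ((2 * C_E) ^ t * g ^ t * e₁ ^ t)
          = C ^ (1 - t) * (2 * C_E) ^ t * g ^ t * (e₁ ^ (1 - t) * e₁ ^ t) * ρ' := by ring
        _ = C ^ (1 - t) * (2 * C_E) ^ t * g ^ t * e₁ * ρ' := by rw [hee]
    rw [hexp] at hint
    exact hint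
  -- lane A's pointwise jet algebra at the displayed objects
  have key := jet_re_diff_ml_transport K k Ψ₀ Ψ₁ B₀ B₁ (θ := θ') (x := 1) (ρ := ρ') (e := e₁) (C := C ^ (1 - t) * (2 * C_E) ^ t * g ^ t) (C_E := C_E * g)
    (C_s := 𝔠.cB) (C_B := C_B) hθ'0 hsθ zero_le_one le_rfl hρ'0 he₁ hc0 (mul_nonneg hCE hg0.le) hcB hCB h₁ h₂ h₃ h₄ h₅
  rw [hTB₁] at key
  show |(jet26 Ψ₁ B₁').re - (jet26 Ψ₀ B₀).re - 0| ≤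
    (5 * (𝔠.cB ^ 2 * (C ^ (1 - t) * (2 * C_E) ^ t * logPowConst (2 * 𝔠.r₀) t) + 6 * 𝔠.cB * C_B * (C_E * logPowConst (2 * 𝔠.r₀) 1))) * e₁ *
      (θBal F.L γ 𝔠.b₀ 𝔠.p₀ n ^ 2 * ρ')
  rw [sub_zero]
  refine key.trans ?_
  -- absorb the polylogarithms and pass to the registered profile
  have hM_t : r ^ 2 * g ^ t ≤ logPowConst (2 * 𝔠.r₀) t := rsq_mul_rpow_le hr hg0 hg1 ht
  have hM_1 : r ^ 2 * g ≤ logPowConst (2 * 𝔠.r₀) 1 := by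
    have h := rsq_mul_rpow_le hr hg0 hg1 one_pos
    rwa [Real.rpow_one] at h
  have hθn : θBal F.L γ 𝔠.b₀ 𝔠.p₀ (n + 1) ^ 2 ≤ θBal F.L γ 𝔠.b₀ 𝔠.p₀ n ^ 2 :=
    pow_le_pow_left₀ (T3MinimiserStabilityReduction.θBal_pos hL hγ hγ1' 𝔠.b₀_pos 𝔠.p₀ (n + 1)).le
      (θBal_succ_le hL hγ hγ1' hγe 𝔠.b₀_pos.le 𝔠.p₀_pos.le n) 2
  have hθ'sq : θ' ^ 2 = r ^ 2 * (g * pg) ^ 2 := by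
    show (r * g * pg) ^ 2 = r ^ 2 * (g * pg) ^ 2
    ring
  have hMt0 : 0 ≤ logPowConst (2 * 𝔠.r₀) t := (logPowConst_pos (by positivity) ht).le
  have hM10 : 0 ≤ logPowConst (2 * 𝔠.r₀) 1 := (logPowConst_pos (by positivity) one_pos).le
  -- the two coefficient products
  have hI : (C ^ (1 - t) * (2 * C_E) ^ t * g ^ t) * θ' ^ 2 ≤ (C ^ (1 - t) * (2 * C_E) ^ t * logPowConst (2 * 𝔠.r₀) t) * θBal F.L γ 𝔠.b₀ 𝔠.p₀ n ^ 2 := by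
    have hc : 0 ≤ C ^ (1 - t) * (2 * C_E) ^ t := mul_nonneg (Real.rpow_nonneg hC _) (Real.rpow_nonneg (by linarith) _)
    calc (C ^ (1 - t) * (2 * C_E) ^ t * g ^ t) * θ' ^ 2 = (C ^ (1 - t) * (2 * C_E) ^ t) * ((r ^ 2 * g ^ t) * (g * pg) ^ 2) := by
          rw [hθ'sq]; ring
      _ ≤ (C ^ (1 - t) * (2 * C_E) ^ t) * (logPowConst (2 * 𝔠.r₀) t * θBal F.L γ 𝔠.b₀ 𝔠.p₀ n ^ 2) := by
          rw [heps]
          exact mul_le_mul_of_nonneg_left (mul_le_mul hM_t hθn (sq_nonneg _) hMt0) hc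
      _ = _ := by ring
  have hII : (C_E * g) * θ' ^ 2 ≤ (C_E * logPowConst (2 * 𝔠.r₀) 1) * θBal F.L γ 𝔠.b₀ 𝔠.p₀ n ^ 2 := by
    calc (C_E * g) * θ' ^ 2 = C_E * ((r ^ 2 * g) * (g * pg) ^ 2) := by rw [hθ'sq]; ring
      _ ≤ C_E * (logPowConst (2 * 𝔠.r₀) 1 * θBal F.L γ 𝔠.b₀ 𝔠.p₀ n ^ 2) := by
          rw [heps]
          exact mul_le_mul_of_nonneg_left (mul_le_mul hM_1 hθn (sq_nonneg _) hM10) hCE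
      _ = _ := by ring
  have hsum : 𝔠.cB ^ 2 * ((C ^ (1 - t) * (2 * C_E) ^ t * g ^ t) * θ' ^ 2) + 6 * 𝔠.cB * C_B * ((C_E * g) * θ' ^ 2) ≤
      𝔠.cB ^ 2 * ((C ^ (1 - t) * (2 * C_E) ^ t * logPowConst (2 * 𝔠.r₀) t) * θBal F.L γ 𝔠.b₀ 𝔠.p₀ n ^ 2) +
        6 * 𝔠.cB * C_B * ((C_E * logPowConst (2 * 𝔠.r₀) 1) * θBal F.L γ 𝔠.b₀ 𝔠.p₀ n ^ 2) :=
    add_le_add (mul_le_mul_of_nonneg_left hI (sq_nonneg _)) (mul_le_mul_of_nonneg_left hII (by positivity))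
  calc 5 * (𝔠.cB ^ 2 * (C ^ (1 - t) * (2 * C_E) ^ t * g ^ t) + 6 * 𝔠.cB * C_B * (C_E * g)) * e₁ * 1 ^ 4 * (θ' ^ 2 * ρ')
      = 5 * e₁ * ρ' * (𝔠.cB ^ 2 * ((C ^ (1 - t) * (2 * C_E) ^ t * g ^ t) * θ' ^ 2) + 6 * 𝔠.cB * C_B * ((C_E * g) * θ' ^ 2)) := by ring
    _ ≤ 5 * e₁ * ρ' * (𝔠.cB ^ 2 * ((C ^ (1 - t) * (2 * C_E) ^ t * logPowConst (2 * 𝔠.r₀) t) * θBal F.L γ 𝔠.b₀ 𝔠.p₀ n ^ 2) +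
          6 * 𝔠.cB * C_B * ((C_E * logPowConst (2 * 𝔠.r₀) 1) * θBal F.L γ 𝔠.b₀ 𝔠.p₀ n ^ 2)) :=
        mul_le_mul_of_nonneg_left hsum (by positivity)
    _ = _ := by ring

end Summit.QuantumFields.YangMills.Theorems.GlobalSlackCanonicalPolymers

end
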